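import Literature.InformationTheory.Coding.SourcePolarizationStep
import HarnessLib

/-!
# One step of source polarization, VI: splitting the polar transform on the top bit

Theorem-only companion of `Literature/InformationTheory/Coding/SourcePolarizationStep.lean`:
the combinatorics of the natural-order polar transform `polarBit` under the pairing of copy `c`
with copy `2^s + c` (`loIdx`, `hiIdx`, `cfgMinus`, `cfgPlus`):

* bit arithmetic of `2^s + c` (`two_pow_add_and`, `and_two_pow_add`,
  `two_pow_add_and_two_pow_add`), splitting sums over `Fin (2^(s+1))` (`sum_univ_two_pow_succ`);
* THE ONE-STEP RECURSION OF THE POLAR TRANSFORM (`polarBit_succ_lo`, `polarBit_succ_hi`):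
  `U^{(s+1)}_j(b) = U^{(s)}_j(b_lo + b_hi)` and `U^{(s+1)}_{2^s + j}(b) = U^{(s)}_j(b_hi)` for
  `j < 2^s` — the recursion `F^{⊗(s+1)} = F ⊗ F^{⊗ s}` of [Arıkan 2009, §VII] in natural index
  order;
* the pairings `cfgMinus s`, `cfgPlus s : Cfg (s+1) m → Cfg s (m+m+1)` are bijections
  (`cfgMinus_bijective`, `cfgPlus_bijective`), and a function on `Fin (2^(s+1))` is determined by
  its values on low and high indices (`eq_iff_lo_hi`).

## References

* E. Arıkan, *Channel polarization…*, IEEE Trans. IT 55 (2009), §VII (recursive structure of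
  `G_N = B_N F^{⊗n}`).  bib `Arikan2009`.
-/

namespace Literature.InformationTheory.Coding.Polar

open Finset

/-! ### Bit arithmetic of `2^s + c` -/

/-- `AND` with a number below `2^s` ignores bit `s`: `(2^s + c) AND j = c AND j` for `j < 2^s`.
[folklore] -/
theorem two_pow_add_and {s j : ℕ} (hj : j < 2 ^ s) (c : ℕ) : (2 ^ s + c) &&& j = c &&& j := by
  apply Nat.eq_of_testBit_eq
  intro i
  rw [Nat.testBit_and, Nat.testBit_and]
  rcases lt_or_ge i s with hi | hi
  · rw [Nat.testBit_two_pow_add_gt hi]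
  · have : j.testBit i = false :=
      Nat.testBit_lt_two_pow (lt_of_lt_of_le hj (Nat.pow_le_pow_right two_pos hi))
    simp [this]

/-- A number below `2^s` has no bit `s`: `c AND (2^s + j) = c AND j` for `c < 2^s`. [folklore] -/
theorem and_two_pow_add {s c : ℕ} (hc : c < 2 ^ s) (j : ℕ) : c &&& (2 ^ s + j) = c &&& j := by
  apply Nat.eq_of_testBit_eq
  intro i
  rw [Nat.testBit_and, Nat.testBit_and]
  rcases lt_or_ge i s with hi | hi
  · rw [Nat.testBit_two_pow_add_gt hi]
  · have : c.testBit i = false :=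
      Nat.testBit_lt_two_pow (lt_of_lt_of_le hc (Nat.pow_le_pow_right two_pos hi))
    simp [this]

/-- Bit `s` is common: `(2^s + c) AND (2^s + j) = 2^s + (c AND j)` for `c, j < 2^s`. [folklore] -/
theorem two_pow_add_and_two_pow_add {s c j : ℕ} (hc : c < 2 ^ s) (hj : j < 2 ^ s) :
    (2 ^ s + c) &&& (2 ^ s + j) = 2 ^ s + (c &&& j) := by
  apply Nat.eq_of_testBit_eq
  intro i
  rw [Nat.testBit_and]
  rcases lt_trichotomy i s with hi | rfl | hi
  · rw [Nat.testBit_two_pow_add_gt hi, Nat.testBit_two_pow_add_gt hi, Nat.testBit_two_pow_add_gt hi,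
      Nat.testBit_and]
  · rw [Nat.testBit_two_pow_add_eq, Nat.testBit_two_pow_add_eq, Nat.testBit_two_pow_add_eq,
      Nat.testBit_and, Nat.testBit_lt_two_pow hc, Nat.testBit_lt_two_pow hj]
    rfl
  · have hpow : 2 ^ (i - 1 - s) * 2 ^ s * 2 = 2 ^ i := by
      rw [← pow_add, ← pow_succ]
      congr 1
      omega
    have hle : 2 ^ s + 2 ^ s ≤ 2 ^ i := by
      have : 1 ≤ 2 ^ (i - 1 - s) := Nat.one_le_two_pow
      nlinarith
    have hcj : c &&& j ≤ c := Nat.and_le_left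
    rw [Nat.testBit_lt_two_pow (by omega : 2 ^ s + c < 2 ^ i),
      Nat.testBit_lt_two_pow (by omega : 2 ^ s + j < 2 ^ i),
      Nat.testBit_lt_two_pow (by omega : 2 ^ s + (c &&& j) < 2 ^ i)]
    rfl

/-! ### Splitting sums and the polar transform on the top bit -/

/-- A sum over `Fin (2^(s+1))` splits into the low indices `c` and the high indices `2^s + c`.
[folklore] -/
theorem sum_univ_two_pow_succ {M : Type*} [AddCommMonoid M] (s : ℕ) (f : Fin (2 ^ (s + 1)) → M) :
    ∑ i, f i = ∑ c : Fin (2 ^ s), f (loIdx s c) + ∑ c : Fin (2 ^ s), f (hiIdx s c) := by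
  rw [← Equiv.sum_comp (finSumFinEquiv.trans (finCongr (two_pow_succ_eq s).symm)) f,
    Fintype.sum_sum_type]
  rfl

/-- **Recursion of the polar transform, low half**: for `j < 2^s`,
`U^{(s+1)}_j(b) = U^{(s)}_j(c ↦ b_c + b_{2^s+c})` (row `j` of `F^{⊗(s+1)}` in natural order).
[cite: Arikan2009, §VII (recursive structure of G_N)] -/
theorem polarBit_succ_lo (s : ℕ) (j : Fin (2 ^ s)) (b : Fin (2 ^ (s + 1)) → ZMod 2) :
    polarBit (s + 1) (loIdx s j) b = polarBit s j fun c => b (loIdx s c) + b (hiIdx s c) := by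
  unfold polarBit
  rw [sum_univ_two_pow_succ, ← Finset.sum_add_distrib]
  refine Finset.sum_congr rfl fun c _ => ?_
  simp only [loIdx_val, hiIdx_val, two_pow_add_and j.isLt]
  split_ifs <;> simp

/-- **Recursion of the polar transform, high half**: for `j < 2^s`,
`U^{(s+1)}_{2^s + j}(b) = U^{(s)}_j(c ↦ b_{2^s+c})`. [cite: Arikan2009, §VII (recursive structure of G_N)] -/
theorem polarBit_succ_hi (s : ℕ) (j : Fin (2 ^ s)) (b : Fin (2 ^ (s + 1)) → ZMod 2) :
    polarBit (s + 1) (hiIdx s j) b = polarBit s j fun c => b (hiIdx s c) := by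
  unfold polarBit
  rw [sum_univ_two_pow_succ]
  have h0 : ∑ c : Fin (2 ^ s),
      (if (loIdx s c).val &&& (hiIdx s j).val = (hiIdx s j).val then b (loIdx s c) else 0) = 0 := by
    refine Finset.sum_eq_zero fun c _ => ?_
    rw [if_neg]
    rw [loIdx_val, hiIdx_val, and_two_pow_add c.isLt]
    have : c.val &&& j.val ≤ j.val := Nat.and_le_right
    omega
  rw [h0, zero_add]
  refine Finset.sum_congr rfl fun c _ => ?_
  simp only [hiIdx_val, two_pow_add_and_two_pow_add c.isLt j.isLt, Nat.add_left_cancel_iff]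

/-! ### The pairings are bijections -/

/-- An index of `Fin (2^(s+1))` is a low or a high index. [folklore] -/
theorem eq_loIdx_or_eq_hiIdx (s : ℕ) (i : Fin (2 ^ (s + 1))) :
    (∃ c, i = loIdx s c) ∨ ∃ c, i = hiIdx s c := by
  by_cases hi : i.val < 2 ^ s
  · exact Or.inl ⟨⟨i.val, hi⟩, Fin.ext rfl⟩
  · have h2 : i.val - 2 ^ s < 2 ^ s := by
      have := i.isLt
      have h2 := two_pow_succ_eq s
      omega
    exact Or.inr ⟨⟨i.val - 2 ^ s, h2⟩, Fin.ext (by simp only [hiIdx_val]; omega)⟩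

/-- A function on `Fin (2^(s+1))` is determined by its values at low and high indices. [folklore] -/
theorem eq_iff_lo_hi {γ : Type*} (s : ℕ) (F F' : Fin (2 ^ (s + 1)) → γ) :
    F = F' ↔ (fun c => (F (loIdx s c), F (hiIdx s c))) = fun c => (F' (loIdx s c), F' (hiIdx s c)) := by
  constructor
  · rintro rfl
    rfl
  · intro h
    funext i
    rcases eq_loIdx_or_eq_hiIdx s i with ⟨c, rfl⟩ | ⟨c, rfl⟩
    · exact congrArg Prod.fst (congr_fun h c)
    · exact congrArg Prod.snd (congr_fun h c)

/-- The number of configurations: `|Cfg s m| = (2 · 2^m)^(2^s)`. [folklore] -/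
theorem card_cfg (s m : ℕ) : Fintype.card (Cfg s m) = (2 * 2 ^ m) ^ (2 ^ s) := by
  simp [Fintype.card_prod, ZMod.card, Fintype.card_fin]

/-- `2^(s+1)` copies of `F₂ × F₂^m` are as many points as `2^s` copies of `F₂ × F₂^{m+m+1}`.
[folklore] -/
theorem card_cfg_succ (s m : ℕ) : Fintype.card (Cfg (s + 1) m) = Fintype.card (Cfg s (m + m + 1)) := by
  rw [card_cfg, card_cfg, show 2 * 2 ^ (m + m + 1) = (2 * 2 ^ m) ^ 2 by ring, ← pow_mul]
  congr 1
  rw [pow_succ]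
  ring

/-- The minus pairing is injective. [folklore] -/
theorem cfgMinus_injective {m : ℕ} (s : ℕ) : Function.Injective (cfgMinus (m := m) s) := by
  intro X X' h
  rw [eq_iff_lo_hi s]
  funext c
  have h1 := congr_fun h c
  simp only [cfgMinus_apply, Prod.mk.injEq, Equiv.apply_eq_iff_eq] at h1
  obtain ⟨hu, hb, hw1, hw2⟩ := h1
  rw [hb] at hu
  exact Prod.ext (Prod.ext (add_right_cancel hu) hw1) (Prod.ext hb hw2)

/-- The plus pairing is injective. [folklore] -/
theorem cfgPlus_injective {m : ℕ} (s : ℕ) : Function.Injective (cfgPlus (m := m) s) := by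
  intro X X' h
  rw [eq_iff_lo_hi s]
  funext c
  have h1 := congr_fun h c
  simp only [cfgPlus_apply, Prod.mk.injEq, Equiv.apply_eq_iff_eq] at h1
  obtain ⟨hd, hb, hw1, hw2⟩ := h1
  exact Prod.ext (Prod.ext hb hw1) (Prod.ext hd hw2)

/-- **The minus pairing is a bijection** `Cfg (s+1) m ≃ Cfg s (m+m+1)`. [folklore] -/
theorem cfgMinus_bijective {m : ℕ} (s : ℕ) : Function.Bijective (cfgMinus (m := m) s) :=
  (Fintype.bijective_iff_injective_and_card _).2 ⟨cfgMinus_injective s, card_cfg_succ s m⟩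

/-- **The plus pairing is a bijection** `Cfg (s+1) m ≃ Cfg s (m+m+1)`. [folklore] -/
theorem cfgPlus_bijective {m : ℕ} (s : ℕ) : Function.Bijective (cfgPlus (m := m) s) :=
  (Fintype.bijective_iff_injective_and_card _).2 ⟨cfgPlus_injective s, card_cfg_succ s m⟩

/-- Masked vectors agree iff they agree at the unmasked entries. [folklore] -/
theorem masked_eq_iff {n : ℕ} (P : Fin n → Prop) [DecidablePred P] (u u' : Fin n → ZMod 2) :
    ((fun j => if P j then u j else 0) = fun j => if P j then u' j else 0) ↔
      ∀ j, P j → u j = u' j := by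
  simp only [funext_iff]
  constructor
  · intro h j hj
    have := h j
    rwa [if_pos hj, if_pos hj] at this
  · intro h j
    by_cases hj : P j
    · rw [if_pos hj, if_pos hj, h j hj]
    · rw [if_neg hj, if_neg hj]

end Literature.InformationTheory.Coding.Polar
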